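import Summits.Ventures.YMGap.Thresholds.HaarFourthMomentSUNTrace
import HarnessLib

/-!
# The fourth moment of the `SU(N)` character for `N = 3` and every `N ≥ 5`: `∫ (Re tr U)⁴ dU = 3/4`, i.e. the FOURTH CUMULANT of
# `Re tr U` VANISHES at `β = 0` (row type C-PRESS, `β = 0` inputs, part 19d)

Cell `pub-ymgap`, seat ds-1 (gen 11). HONEST FRAMING: pure compact-group integration for a compact group `G ≅ SU(N)`, `N = 2 + n`,
`N ≥ 3`, `N ∤ 4` (i.e. `N ≠ 4`); nothing lattice-specific beyond the remark below, nothing about the continuum or the Clay problem. Kernel theorems only,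
0 compute, no definitions.

`(Re z)⁴ = (Re z⁴ + 4|z|² Re z² + 3|z|⁴)/8` (`re_pow_four_eq`). For `z = tr ρ(g)`: `∫ z⁴ = 0` when `N ∤ 4` and `∫ |z|² z² = 0` when `N ∤ 2`
(centre twists: `ζ⁴ ≠ 1` iff `N ∤ 4`, `ζ² ≠ 1` iff `N ∤ 2`, `ζ = e^{2πi/N}`), and `∫ |z|⁴ = 2` (part 19c, `N ≥ 3`). Hence for `N ≥ 3`, `N ≠ 4`:
★★ `∫ (Re tr ρ(g))⁴ dg = 3/4` (`integral_reTr_pow_four_SUN`), and with `∫ (Re tr)² = 1/2` (`charVariance_eq_half`):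
★★ `κ₄(Re tr U) = 3/4 − 3·(1/2)² = 0` (`fourthCumulant_reTr_eq_zero`) — the `SU(N)` plaquette character is GAUSSIAN TO FOURTH ORDER at
`β = 0` for `N = 3` and every `N ≥ 5`; contrast `SU(2)` (`κ₄ = 2 − 3 = −1`, part 10, the number behind `f⁗(0) = −6`) and `SU(4)` (where
`∫ tr⁴ = 1` contributes). For `SU(3)` lattice gauge theory: the single-plaquette fourth cumulant of `W_p = (1/3) Re tr U_p` at `β = 0` is `0`.
References: P. Diaconis, M. Shahshahani, J. Appl. Probab. 31A (1994) 49; M. Creutz, *Quarks, gluons and lattices* (1983) §8.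
Everything here is proved. [folklore]
-/

noncomputable section

open MeasureTheory Complex
open Literature.MathematicalPhysics.QuantumLattice Literature.MathematicalPhysics.QuantumFieldTheory

namespace Summit.Ventures.YMGap.HaarFourthMomentSUN

open RobustBall.HaarSecondMoments (integral_comp_mul_left smul_one_mem)
open HaarThirdMomentSU3 (eq_zero_of_mul_eq_self)

section Character

variable {n : ℕ} {G : Type*} [Group G] [TopologicalSpace G] [IsTopologicalGroup G] [CompactSpace G]
  [MeasurableSpace G] [BorelSpace G] (ρ : G →* Matrix (Fin (2 + n)) (Fin (2 + n)) ℂ)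

/-- The pointwise identity `(Re z)⁴ = (Re(z⁴) + 4 Re(|z|²·z²) + 3 |z|⁴)/8` (with `|z|² = z z̄`). [folklore] -/
theorem re_pow_four_eq (z : ℂ) :
    z.re ^ 4 = ((z ^ 4).re + 4 * (z * (starRingEnd ℂ) z * z ^ 2).re + 3 * Complex.normSq z ^ 2) / 8 := by
  have hz : (starRingEnd ℂ) z = ⟨z.re, -z.im⟩ := rfl
  rw [hz, Complex.normSq_apply]
  simp only [pow_succ, pow_zero, one_mul, Complex.mul_re, Complex.mul_im]
  ring

/-- **`∫ (tr ρ(g))⁴ dg = 0` when `N ∤ 4`** (centre twist: `ζ⁴ ≠ 1`). [folklore] -/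
theorem integral_trace_pow_four_eq_zero (hρ : IsSpecialUnitaryModel ρ) (h4 : ¬ (2 + n) ∣ 4) :
    ∫ g, (ρ g).trace ^ 4 ∂haarProbability G = 0 := by
  set ζ : ℂ := Complex.exp (2 * Real.pi * Complex.I / (2 + n : ℕ)) with hζdef
  have hN0 : (2 + n : ℕ) ≠ 0 := by omega
  have hprim : IsPrimitiveRoot ζ (2 + n) := Complex.isPrimitiveRoot_exp (2 + n) hN0
  have hζ4 : ζ ^ 4 ≠ 1 := fun h => h4 ((hprim.pow_eq_one_iff_dvd 4).mp h)
  have hmem : ζ • (1 : Matrix (Fin (2 + n)) (Fin (2 + n)) ℂ) ∈ Matrix.specialUnitaryGroup (Fin (2 + n)) ℂ := by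
    rw [hζdef]; exact smul_one_mem (N := 2 + n) hN0
  have h := integral_comp_mul_left ρ hρ hmem (fun M => M.trace ^ 4)
  have ht : ∀ M : Matrix (Fin (2 + n)) (Fin (2 + n)) ℂ, (ζ • (1 : Matrix (Fin (2 + n)) (Fin (2 + n)) ℂ) * M).trace ^ 4 =
      ζ ^ 4 * M.trace ^ 4 := fun M => by rw [smul_mul_assoc, one_mul, Matrix.trace_smul, smul_eq_mul, mul_pow]
  simp only [ht] at h
  rw [integral_const_mul] at h
  exact eq_zero_of_mul_eq_self hζ4 h

/-- **`∫ |tr ρ(g)|² (tr ρ(g))² dg = 0` for `N ≥ 3`** (centre twist: `|tr|²` is invariant, `tr² ↦ ζ² tr²`, `ζ² ≠ 1`). [folklore] -/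
theorem integral_normSq_mul_trace_sq_eq_zero (hρ : IsSpecialUnitaryModel ρ) (hn : 1 ≤ n) :
    ∫ g, (ρ g).trace * (starRingEnd ℂ) (ρ g).trace * (ρ g).trace ^ 2 ∂haarProbability G = 0 := by
  set ζ : ℂ := Complex.exp (2 * Real.pi * Complex.I / (2 + n : ℕ)) with hζdef
  have hN0 : (2 + n : ℕ) ≠ 0 := by omega
  have hprim : IsPrimitiveRoot ζ (2 + n) := Complex.isPrimitiveRoot_exp (2 + n) hN0
  have hζ2 : ζ ^ 2 ≠ 1 := fun h => by
    have := Nat.le_of_dvd two_pos ((hprim.pow_eq_one_iff_dvd 2).mp h); omega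
  have hnorm : ‖ζ‖ = 1 := hprim.norm'_eq_one hN0
  have hconj : ζ * (starRingEnd ℂ) ζ = 1 := by
    rw [Complex.mul_conj, Complex.normSq_eq_norm_sq, hnorm]; simp
  have hmem : ζ • (1 : Matrix (Fin (2 + n)) (Fin (2 + n)) ℂ) ∈ Matrix.specialUnitaryGroup (Fin (2 + n)) ℂ := by
    rw [hζdef]; exact smul_one_mem (N := 2 + n) hN0
  have h := integral_comp_mul_left ρ hρ hmem (fun M => M.trace * (starRingEnd ℂ) M.trace * M.trace ^ 2)
  have ht : ∀ M : Matrix (Fin (2 + n)) (Fin (2 + n)) ℂ,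
      (ζ • (1 : Matrix (Fin (2 + n)) (Fin (2 + n)) ℂ) * M).trace * (starRingEnd ℂ) (ζ • (1 : Matrix (Fin (2 + n)) (Fin (2 + n)) ℂ) * M).trace
        * (ζ • (1 : Matrix (Fin (2 + n)) (Fin (2 + n)) ℂ) * M).trace ^ 2 =
      ζ ^ 2 * (M.trace * (starRingEnd ℂ) M.trace * M.trace ^ 2) := by
    intro M
    rw [smul_mul_assoc, one_mul, Matrix.trace_smul, smul_eq_mul, map_mul]
    linear_combination (ζ ^ 2 * M.trace * (starRingEnd ℂ) M.trace * M.trace ^ 2) * hconj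
  simp only [ht] at h
  rw [integral_const_mul] at h
  exact eq_zero_of_mul_eq_self hζ2 h

/-- ★★ **`∫ (Re tr ρ(g))⁴ dg = 3/4` for `G ≅ SU(N)`, `N ≥ 3`, `N ≠ 4`** — three quarters of `∫|tr|⁴ = 2`, the other terms of
`(Re z)⁴` dying by the centre. [folklore] -/
theorem integral_reTr_pow_four_SUN (hρ : IsSpecialUnitaryModel ρ) (hn : 1 ≤ n) (h4 : ¬ (2 + n) ∣ 4) :
    ∫ g, PlaquetteLowerBound.reTr ρ g ^ 4 ∂haarProbability G = 3 / 4 := by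
  unfold PlaquetteLowerBound.reTr
  simp_rw [re_pow_four_eq]
  have hc : Continuous fun g : G => (ρ g).trace := hρ.1.matrix_trace
  have hi4c : Integrable (fun g : G => (ρ g).trace ^ 4) (haarProbability G) :=
    (hc.pow 4).integrable_of_hasCompactSupport (HasCompactSupport.of_compactSpace _)
  have hi22c : Integrable (fun g : G => (ρ g).trace * (starRingEnd ℂ) (ρ g).trace * (ρ g).trace ^ 2) (haarProbability G) :=
    ((hc.mul (Complex.continuous_conj.comp hc)).mul (hc.pow 2)).integrable_of_hasCompactSupport
      (HasCompactSupport.of_compactSpace _)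
  have hi4 : Integrable (fun g : G => ((ρ g).trace ^ 4).re) (haarProbability G) := hi4c.re
  have hi22 : Integrable (fun g : G => 4 * ((ρ g).trace * (starRingEnd ℂ) (ρ g).trace * (ρ g).trace ^ 2).re)
      (haarProbability G) := hi22c.re.const_mul 4
  have hiN : Integrable (fun g : G => 3 * Complex.normSq (ρ g).trace ^ 2) (haarProbability G) :=
    (((Complex.continuous_normSq.comp hc).pow 2).const_mul 3).integrable_of_hasCompactSupport
      (HasCompactSupport.of_compactSpace _)
  have hi12 : Integrable (fun g : G => ((ρ g).trace ^ 4).re +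
      4 * ((ρ g).trace * (starRingEnd ℂ) (ρ g).trace * (ρ g).trace ^ 2).re) (haarProbability G) := hi4.add hi22
  rw [integral_div, integral_add hi12 hiN, integral_add hi4 hi22, integral_const_mul, integral_const_mul,
    integral_normSq_trace_sq ρ hρ hn]
  have e4 : ∫ g, ((ρ g).trace ^ 4).re ∂haarProbability G = 0 := by
    have h := integral_re hi4c
    rw [integral_trace_pow_four_eq_zero ρ hρ h4] at h
    simpa using h
  have e22 : ∫ g, ((ρ g).trace * (starRingEnd ℂ) (ρ g).trace * (ρ g).trace ^ 2).re ∂haarProbability G = 0 := by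
    have h := integral_re hi22c
    rw [integral_normSq_mul_trace_sq_eq_zero ρ hρ hn] at h
    simpa using h
  rw [e4, e22]
  norm_num

/-- ★★ **THE FOURTH CUMULANT OF THE `SU(N)` CHARACTER VANISHES AT `β = 0` for `N = 3` and every `N ≥ 5`**:
`∫ (Re tr)⁴ − 3 (∫ (Re tr)²)² = 3/4 − 3·(1/2)² = 0` (`G ≅ SU(N)`, `N ≥ 3`, `N ≠ 4`; the odd moments vanish, so this is `κ₄`).
[folklore] -/
theorem fourthCumulant_reTr_eq_zero (hρ : IsSpecialUnitaryModel ρ) (hn : 1 ≤ n) (h4 : ¬ (2 + n) ∣ 4) :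
    (∫ g, PlaquetteLowerBound.reTr ρ g ^ 4 ∂haarProbability G) -
      3 * (∫ g, PlaquetteLowerBound.reTr ρ g ^ 2 ∂haarProbability G) ^ 2 = 0 := by
  have hV := RobustBall.HaarSecondMoments.charVariance_eq_half ρ hρ (by omega : 3 ≤ 2 + n)
  unfold PlaquetteLowerBound.charVariance at hV
  rw [integral_reTr_pow_four_SUN ρ hρ hn h4, hV]
  norm_num

/-- ★ The same for the normalised plaquette variable `W = (1/N) Re tr U`: `E W⁴ − 3 (E W²)² = 0` at `β = 0` (`N ≥ 3`, `N ≠ 4`).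
[folklore] -/
theorem fourthCumulant_plaquetteVariable_eq_zero (hρ : IsSpecialUnitaryModel ρ) (hn : 1 ≤ n) (h4 : ¬ (2 + n) ∣ 4) :
    (∫ g, (((2 + n : ℕ) : ℝ)⁻¹ * PlaquetteLowerBound.reTr ρ g) ^ 4 ∂haarProbability G) -
      3 * (∫ g, (((2 + n : ℕ) : ℝ)⁻¹ * PlaquetteLowerBound.reTr ρ g) ^ 2 ∂haarProbability G) ^ 2 = 0 := by
  simp_rw [mul_pow]
  rw [integral_const_mul, integral_const_mul]
  have h := fourthCumulant_reTr_eq_zero ρ hρ hn h4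
  have hV := RobustBall.HaarSecondMoments.charVariance_eq_half ρ hρ (by omega : 3 ≤ 2 + n)
  unfold PlaquetteLowerBound.charVariance at hV
  rw [integral_reTr_pow_four_SUN ρ hρ hn h4, hV] at h ⊢
  ring

end Character

/-! ### The concrete groups `SU(3)` and `SU(N)`, `N ≥ 5` -/

/-- ★★ **`∫_{SU(3)} (Re tr U)⁴ dU = 3/4`.** [folklore] -/
theorem integral_reTr_pow_four_su3 :
    ∫ U, ((U : Matrix (Fin 3) (Fin 3) ℂ).trace.re) ^ 4 ∂haarProbability (Matrix.specialUnitaryGroup (Fin 3) ℂ) = 3 / 4 := by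
  have h := integral_reTr_pow_four_SUN (n := 1) (fundamentalRep (Fin 3)) (TorusAreaLaw.isSpecialUnitaryModel_fundamentalRep 3)
    le_rfl (by norm_num)
  simpa only [PlaquetteLowerBound.reTr, fundamentalRep_apply] using h

/-- ★★ **`SU(3)`: the fourth cumulant of the plaquette variable `W = (1/3) Re tr U` at `β = 0` is ZERO**:
`∫ W⁴ − 3 (∫ W²)² = 0` (`∫ W² = 1/18`, `∫ W⁴ = 1/108`). [folklore] -/
theorem su3_fourthCumulant_plaquetteVariable_eq_zero :
    (∫ U, ((3 : ℝ)⁻¹ * (U : Matrix (Fin 3) (Fin 3) ℂ).trace.re) ^ 4 ∂haarProbability (Matrix.specialUnitaryGroup (Fin 3) ℂ)) -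
      3 * (∫ U, ((3 : ℝ)⁻¹ * (U : Matrix (Fin 3) (Fin 3) ℂ).trace.re) ^ 2
        ∂haarProbability (Matrix.specialUnitaryGroup (Fin 3) ℂ)) ^ 2 = 0 := by
  have h := fourthCumulant_plaquetteVariable_eq_zero (n := 1) (fundamentalRep (Fin 3))
    (TorusAreaLaw.isSpecialUnitaryModel_fundamentalRep 3) le_rfl (by norm_num)
  have e3 : ((2 + 1 : ℕ) : ℝ) = 3 := by norm_num
  simp only [e3, PlaquetteLowerBound.reTr, fundamentalRep_apply] at h
  exact h

/-- ★★ **`∫_{SU(N)} (Re tr U)⁴ dU = 3/4` for every `N ≥ 3` with `N ≠ 4`.** [folklore] -/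
theorem integral_reTr_pow_four_suN {N : ℕ} (hN : 3 ≤ N) (hN4 : N ≠ 4) :
    ∫ U, ((U : Matrix (Fin N) (Fin N) ℂ).trace.re) ^ 4 ∂haarProbability (Matrix.specialUnitaryGroup (Fin N) ℂ) = 3 / 4 := by
  obtain ⟨n, rfl⟩ := Nat.exists_eq_add_of_le (show 2 ≤ N by omega)
  have h4 : ¬ (2 + n) ∣ 4 := by
    intro h
    have hle := Nat.le_of_dvd (by norm_num) h
    obtain rfl | rfl : n = 1 ∨ n = 2 := by omega
    · norm_num at h
    · omega
  have h := integral_reTr_pow_four_SUN (n := n) (fundamentalRep (Fin (2 + n)))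
    (TorusAreaLaw.isSpecialUnitaryModel_fundamentalRep (2 + n)) (by omega) h4
  simpa only [PlaquetteLowerBound.reTr, fundamentalRep_apply] using h

end Summit.Ventures.YMGap.HaarFourthMomentSUN
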